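import Literature.Geometry.GeometricMeasureTheory.CurrentsConstancy
import Literature.Geometry.GeometricMeasureTheory.CubicalModel
import Literature.Geometry.GeometricMeasureTheory.MassComplete
import Literature.Geometry.GeometricMeasureTheory.CurrentsPolar
import Literature.Geometry.GeometricMeasureTheory.CurrentsLipschitzPushforward
import Literature.Geometry.GeometricMeasureTheory.CurrentsSupportTheorem
import HarnessLib

/-!
# Integral polyhedral structure of rectifiable currents carried by the cubical skeleton

Support file for the proof of the named fact
`Literature.Geometry.GeometricMeasureTheory.Federer1969_compactness_integralCurrents`
(Federer–Fleming compactness, [Federer1969, 4.2.17 (2)]). In the deformation theorem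
[Federer1969, 4.2.9] the current `P = (σ_m ∘ τ_a)_{#v} T − Q_{m−1}` is rectifiable, carried by the
scaled `m`-skeleton `μ_ε W'_m`, and `∂P` is carried by `μ_ε W'_{m−1}`; Federer concludes by the
constancy theorem 4.1.31 that `P ⌞ μ_ε W'(z) = a_z ⟦μ_ε W'(z)⟧` with `a_z ∈ ℤ` for every `m`-face,
so `P ∈ 𝓟_m` is an integral polyhedral chain of the subdivision; in 4.2.17 the finiteness of the
set of such `P` with bounded mass and support gives total boundedness. This file proves exactly
these two steps in the tree's vocabulary (`CubicalModel.lean`, `CurrentsConstancy.lean`):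

* `Current.IsRectifiable.exists_eq_sum_faceV` — **polyhedral structure**: `P ∈ 𝓡_{k+1}(V)` with
  `spt P ⊆ μ_ε W'_{k+1}` and `∂P = 0` off `μ_ε W'_k` equals `Σ_{z ∈ F} a_z ⟦μ_ε W'(z)⟧`, `F` the
  `(k+1)`-faces meeting `spt P`, `a_z ∈ ℤ`, with the coefficient bound
  `|a_z| 𝓗^{k+1}(W'(z) ∩ 𝔹(μ_ε z, ε/4)) ≤ ‖ω_z‖ 𝐌(P)` (test `P ⌞ W'(z)` against a bump times the
  frame covector `ω_z`). Ingredients: `‖P‖(μ_ε W'_k) = 0` (`𝓗^{k+1}`-null skeleton), the faces are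
  pairwise disjoint and locally finite, `P ⌞ W'(z) = P ⌞ ballV z`, and the constancy theorem
  `Current.IsRectifiable.exists_int_restrictSet_eq_face` on the open neighbourhood `ballV z`, which
  meets `μ_ε W'_{k+1}` in `W'(z)` and misses `μ_ε W'_k`.
* `Cubical.finite_setOf_polyhedral` — **finiteness**: for bounded `K` and `M < ∞` the set of such
  `P` with `spt P ⊆ K`, `𝐌(P) ≤ M` is finite.
* face lemmas: `Cubical.disjoint_face(V)`, `measurableSet_face(V)`, `finite_faces_meeting`,
  `ball_inter_plane_subset_faceV`, `euclideanHausdorffMeasure_faceV_inter_closedBall_pos`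
  (faces contain isometric copies of balls, hence have positive `𝓗^{dim}`-measure);
  `Current.IsRectifiable.mass_ne_top'`, `Current.IsRepresentable.restrictSet_biUnion_finset`.

Definitions with bodies (`Cubical.faceFrame'`) + theorems; no named facts.

## References

* H. Federer, *Geometric Measure Theory*, Springer 1969, 4.1.31, 4.2.5, 4.2.9, 4.2.17 (held copy
  `lit book:federernd-geometric-measure-theory`, PDF pp. 330, 339–340, 344–345, 351) [Federer1969].
-/

noncomputable section

open scoped Distributions ENNReal NNReal Topology ContDiff InnerProductSpace RealInnerProductSpace
open MeasureTheory TopologicalSpace Set Filter Metric Function Module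

namespace Literature.Geometry.GeometricMeasureTheory

set_option maxSynthPendingDepth 2

namespace Cubical

variable {V : Type*} [NormedAddCommGroup V] [InnerProductSpace ℝ V] {n : ℕ}
  (b : OrthonormalBasis (Fin n) ℝ V) {ε : ℝ}

/-! ### Faces: disjointness, local finiteness, measurability, inner balls -/

omit b in
/-- Distinct lattice points have disjoint faces. [cite: Federer1969, 4.2.5] -/
theorem disjoint_face {z z' : Fin n → ℤ} (h : z ≠ z') : Disjoint (face z) (face z') := by
  refine Set.disjoint_left.2 fun x hx hx' => h (funext fun i => ?_)
  have h1 := hx i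
  have h2 := hx' i
  rcases Int.even_or_odd (z i) with he | ho <;> rcases Int.even_or_odd (z' i) with he' | ho'
  · have a := h1.2 he; have c := h2.2 he'
    have : |((z i : ℤ) : ℝ) - z' i| < 2 := by
      have := abs_sub_lt_iff.1 a; have := abs_sub_lt_iff.1 c
      rw [abs_sub_lt_iff]; constructor <;> linarith
    have hlt : |z i - z' i| < 2 := by exact_mod_cast this
    obtain ⟨d, hd⟩ := (Int.even_sub.2 (iff_of_true he he'))
    have : |d| < 1 := by
      rw [hd, ← two_mul, abs_mul, abs_two] at hlt
      linarith [abs_nonneg d]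
    have := abs_lt.1 this
    omega
  · have a := h1.2 he; have c := h2.1 ho'
    rw [c] at a
    have : |((z' i : ℤ) : ℝ) - z i| < 1 := a
    have := eq_of_abs_sub_lt_one this
    exact this.symm
  · have a := h1.1 ho; have c := h2.2 he'
    rw [a] at c
    exact eq_of_abs_sub_lt_one c
  · have a := h1.1 ho; have c := h2.1 ho'
    exact_mod_cast a.symm.trans c

/-- Distinct lattice points have disjoint scaled faces in `V`. [cite: Federer1969, 4.2.5] -/
theorem disjoint_faceV {z z' : Fin n → ℤ} (h : z ≠ z') : Disjoint (faceV b ε z) (faceV b ε z') :=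
  Set.disjoint_left.2 fun _ hx hx' => Set.disjoint_left.1 (disjoint_face h) hx hx'

omit b in
/-- Faces are measurable. [folklore] -/
theorem measurableSet_face (z : Fin n → ℤ) : MeasurableSet (face z) := by
  have : face z = ⋂ i, ({x : Fin n → ℝ | Odd (z i) → x i = z i} ∩ {x | Even (z i) → |x i - z i| < 1}) := by
    ext x; simp [face, Set.mem_iInter]
  rw [this]
  refine MeasurableSet.iInter fun i => MeasurableSet.inter ?_ ?_
  · by_cases h : Odd (z i)
    · simp only [h, forall_true_left]
      exact (isClosed_eq (continuous_apply i) continuous_const).measurableSet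
    · simp [h]
  · by_cases h : Even (z i)
    · simp only [h, forall_true_left]
      exact (isOpen_lt (continuous_abs.comp ((continuous_apply i).sub continuous_const))
        continuous_const).measurableSet
    · simp [h]

variable [FiniteDimensional ℝ V] [MeasurableSpace V] [BorelSpace V]

omit [FiniteDimensional ℝ V] in
/-- Scaled faces are measurable. [folklore] -/
theorem measurableSet_faceV (z : Fin n → ℤ) : MeasurableSet (faceV b ε z) :=
  (measurableSet_face z).preimage (measurable_model b)

omit [FiniteDimensional ℝ V] [MeasurableSpace V] [BorelSpace V] in
/-- **Local finiteness of the grid**: only finitely many scaled faces meet a bounded set.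
[cite: Federer1969, 4.2.5] -/
theorem finite_faces_meeting (hε : 0 < ε) {K : Set V} (hK : Bornology.IsBounded K) :
    {z : Fin n → ℤ | (faceV b ε z ∩ K).Nonempty}.Finite := by
  obtain ⟨R, hR⟩ := hK.subset_closedBall 0
  set M : ℤ := ⌈(R + Real.sqrt n * ε) / ε⌉
  refine (Set.Finite.pi (t := fun _ : Fin n => Set.Icc (-M) M) fun _ => Set.finite_Icc _ _).subset
    fun z ⟨x, hxF, hxK⟩ => ?_
  have hc : ‖faceCenter b ε z‖ ≤ R + Real.sqrt n * ε := by
    have h1 := dist_faceCenter_le b hε hxF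
    have h2 : ‖x‖ ≤ R := mem_closedBall_zero_iff.1 (hR hxK)
    calc ‖faceCenter b ε z‖ = dist (faceCenter b ε z) 0 := (dist_zero_right _).symm
      _ ≤ dist (faceCenter b ε z) x + dist x 0 := dist_triangle _ _ _
      _ ≤ Real.sqrt n * ε + R := by rw [dist_comm, dist_zero_right]; exact add_le_add h1 h2
      _ = R + Real.sqrt n * ε := add_comm _ _
  have hi : ∀ i, |(z i : ℝ)| ≤ (R + Real.sqrt n * ε) / ε := fun i => by
    rw [le_div_iff₀ hε]
    have h1 : coord b (faceCenter b ε z) i = ε * z i := by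
      rw [faceCenter, coord_uncoord]; simp
    calc |(z i : ℝ)| * ε = |coord b (faceCenter b ε z) i| := by
          rw [h1, abs_mul, abs_of_pos hε, mul_comm]
      _ ≤ ‖coord b (faceCenter b ε z)‖ := norm_le_pi_norm (coord b (faceCenter b ε z)) i |> fun h => by
          rw [← Real.norm_eq_abs]; exact h
      _ ≤ ‖faceCenter b ε z‖ := norm_coord_le b _
      _ ≤ R + Real.sqrt n * ε := hc
  simp only [Set.mem_pi, Set.mem_univ, forall_true_left, Set.mem_Icc]
  intro i
  have hM := Int.le_ceil ((R + Real.sqrt n * ε) / ε)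
  constructor
  · have h1 := (abs_le.1 (hi i)).1
    have : (-M : ℝ) ≤ z i := by linarith
    exact_mod_cast this
  · have h2 := (abs_le.1 (hi i)).2
    have : (z i : ℝ) ≤ M := h2.trans hM
    exact_mod_cast this

omit [FiniteDimensional ℝ V] [MeasurableSpace V] [BorelSpace V] in
/-- The metric ball of radius `ε` about the lattice point lies in the sup-ball `ballV`. [folklore] -/
theorem ball_faceCenter_subset_ballV (hε : 0 < ε) (z : Fin n → ℤ) :
    ball (faceCenter b ε z) ε ⊆ ballV b ε z := by
  intro x hx
  show model b ε x ∈ ball (fun i => (z i : ℝ)) 1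
  rw [mem_ball] at hx ⊢
  have h1 := dist_model_le b hε x (faceCenter b ε z)
  rw [show model b ε (faceCenter b ε z) = fun i => (z i : ℝ) from model_uncoord_smul b hε.ne' _] at h1
  calc dist (model b ε x) (fun i => (z i : ℝ)) ≤ ε⁻¹ * dist x (faceCenter b ε z) := h1
    _ < ε⁻¹ * ε := mul_lt_mul_of_pos_left hx (inv_pos.2 hε)
    _ = 1 := inv_mul_cancel₀ hε.ne'

omit [FiniteDimensional ℝ V] [MeasurableSpace V] [BorelSpace V] in
/-- The face contains the plane ball of radius `ε` about the lattice point. [cite: Federer1969, 4.2.5] -/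
theorem ball_inter_plane_subset_faceV (hε : 0 < ε) (z : Fin n → ℤ) :
    ball (faceCenter b ε z) ε ∩ {x | x - faceCenter b ε z ∈ faceDirV b z} ⊆ faceV b ε z := by
  rw [← ballV_inter_plane_eq_faceV b hε z]
  exact Set.inter_subset_inter_left _ (ball_faceCenter_subset_ballV b hε z)

/-- **Faces have positive measure**: `𝓗ᵏ(μ_ε W'(z) ∩ 𝔹(μ_ε z, r)) > 0` for `faceDim z = k` and
`0 < r ≤ ε` (the face contains an isometric copy of a `k`-ball). [cite: Federer1969, 4.2.5] -/
theorem euclideanHausdorffMeasure_faceV_inter_closedBall_pos (hε : 0 < ε) {z : Fin n → ℤ} {k : ℕ}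
    (hz : faceDim z = k) {r : ℝ} (hr : 0 < r) (hrε : r ≤ ε) :
    0 < (μHE[k] : Measure V) (faceV b ε z ∩ closedBall (faceCenter b ε z) r) := by
  set P₀ := faceDirV b z
  set p₀ := faceCenter b ε z
  have hfr : Module.finrank ℝ P₀ = k := (finrank_faceDirV b z).trans hz
  -- the isometric copy of the open `r/2`-ball of `P₀`
  have hsub : ZeroGradient.planeEmb P₀ p₀ '' ball (0 : P₀) (r / 2) ⊆ faceV b ε z ∩ closedBall p₀ r := by
    rintro _ ⟨y, hy, rfl⟩
    have hdist : dist (ZeroGradient.planeEmb P₀ p₀ y) p₀ < r / 2 := by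
      have := (ZeroGradient.isometry_planeEmb P₀ p₀).dist_eq y 0
      rw [show ZeroGradient.planeEmb P₀ p₀ 0 = p₀ by simp [ZeroGradient.planeEmb]] at this
      rw [this]; simpa using hy
    refine ⟨ball_inter_plane_subset_faceV b hε z ⟨mem_ball.2 (by linarith), ZeroGradient.planeEmb_mem P₀ p₀ y⟩,
      mem_closedBall.2 (by linarith)⟩
  refine lt_of_lt_of_le ?_ (measure_mono hsub)
  rw [(ZeroGradient.isometry_planeEmb P₀ p₀).euclideanHausdorffMeasure_image, ← hfr,
    InnerProductSpace.euclideanHausdorffMeasure_eq_volume]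
  exact Metric.measure_ball_pos volume _ (by linarith)

end Cubical

/-! ### Integral polyhedral structure on the skeleton -/

section Polyhedral

open Cubical

variable {V : Type*} [NormedAddCommGroup V] [InnerProductSpace ℝ V] [FiniteDimensional ℝ V]
  [MeasurableSpace V] [BorelSpace V] {n : ℕ}

/-- The total face frame: the orthonormal frame of the face when `faceDim z = k`, else `0`.
[folklore] -/
def Cubical.faceFrame' (b : OrthonormalBasis (Fin n) ℝ V) (z : Fin n → ℤ) (k : ℕ) : Fin k → V :=
  if hz : faceDim z = k then faceFrame b z hz else fun _ => 0

omit [FiniteDimensional ℝ V] [MeasurableSpace V] [BorelSpace V] in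
/-- Unfolding `faceFrame'` on a face of the right dimension. [folklore] -/
theorem Cubical.faceFrame'_eq (b : OrthonormalBasis (Fin n) ℝ V) {z : Fin n → ℤ} {k : ℕ} (hz : faceDim z = k) :
    faceFrame' b z k = faceFrame b z hz := by
  unfold faceFrame'; rw [dif_pos hz]

/-- A rectifiable current has finite mass. [cite: Federer1969, 4.1.28] -/
theorem Current.IsRectifiable.mass_ne_top' {m : ℕ} {T : Current (⊤ : Opens V) m} (hT : T.IsRectifiable) :
    T.mass ≠ ⊤ := by
  obtain ⟨W, θ, ξ, hd, hTeq, hWK, -, -⟩ := hT.exists_data_subset hT.2 Subset.rfl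
  have hGint : IntegrableOn (fun y => (θ y : ℝ) • frameVector (ξ y)) W (μHE[m] : Measure V) := by
    have h1 : IntegrableOn (fun y => (θ y : ℝ) • frameVector (ξ y)) T.support ((μHE[m] : Measure V).restrict W) :=
      hd.2.2.2.1.integrableOn_compact_subset (subset_univ _) hT.2
    have : ((μHE[m] : Measure V).restrict W).restrict T.support = (μHE[m] : Measure V).restrict W := by
      rw [Measure.restrict_restrict hT.2.isClosed.measurableSet, Set.inter_eq_right.2 hWK]
    rw [IntegrableOn, this] at h1
    exact h1
  rw [hTeq]
  refine ne_top_of_le_ne_top ?_ hd.mass_le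
  have := hGint.2
  rw [HasFiniteIntegral] at this
  refine ne_top_of_le_ne_top this.ne (lintegral_mono_ae ?_)
  filter_upwards [ae_restrict_mem hd.1, hd.2.2.2.2] with x _ hx
  rw [enorm_smul, ← ofReal_norm (frameVector (ξ x)), norm_frameVector_eq_one hx.1, ENNReal.ofReal_one, mul_one]

/-- Finite additivity of `T ⌞ ·` over pairwise disjoint measurable sets. [folklore] -/
theorem Current.IsRepresentable.restrictSet_biUnion_finset
    {m : ℕ} {T : Current (⊤ : Opens V) m}
    (hT : T.IsRepresentable) {ι : Type*} (F : Finset ι) (A : ι → Set V) (hA : ∀ i, MeasurableSet (A i))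
    (hdisj : ∀ i ∈ F, ∀ j ∈ F, i ≠ j → Disjoint (A i) (A j)) :
    hT.restrictSet (⋃ i ∈ F, A i) (F.measurableSet_biUnion fun i _ => hA i) =
      ∑ i ∈ F, hT.restrictSet (A i) (hA i) := by
  classical
  induction F using Finset.induction_on with
  | empty =>
    have h0 : hT.restrictSet (⋃ i ∈ (∅ : Finset ι), A i) ((∅ : Finset ι).measurableSet_biUnion fun i _ => hA i) = 0 := by
      refine Current.eq_zero_of_mass_eq_zero _ (le_antisymm ((hT.mass_restrictSet_le _).trans ?_) bot_le)
      simp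
    rw [h0, Finset.sum_empty]
  | insert i F hi ih =>
    rw [Finset.sum_insert hi, ← ih fun i' hi' j' hj' h => hdisj i' (Finset.mem_insert_of_mem hi') j'
      (Finset.mem_insert_of_mem hj') h]
    have hdj : Disjoint (A i) (⋃ j ∈ F, A j) := by
      refine Set.disjoint_iUnion₂_right.2 fun j hj => hdisj i (Finset.mem_insert_self i F) j
        (Finset.mem_insert_of_mem hj) fun h => hi (h ▸ hj)
    rw [← hT.restrictSet_union (hA i) (F.measurableSet_biUnion fun j _ => hA j) hdj]
    have : ∀ (B₁ B₂ : Set V) (h₁ : MeasurableSet B₁) (h₂ : MeasurableSet B₂), B₁ = B₂ →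
        hT.restrictSet B₁ h₁ = hT.restrictSet B₂ h₂ := by
      intro B₁ B₂ h₁ h₂ h; subst h; rfl
    exact this _ _ _ _ (Finset.set_biUnion_insert i F A)

/-- **Integral polyhedral structure of a rectifiable current on the skeleton** [Federer1969,
4.2.9, the step "using 4.1.31 we find that P ⌞ μ_ε(V) = (…) for some integer": here `V` runs over
the open neighbourhoods `ballV z` of the `(k+1)`-faces]. If `P ∈ 𝓡_{k+1}(V)` is carried by the
scaled `(k+1)`-skeleton `μ_ε W'_{k+1}` and `∂P` vanishes off the `k`-skeleton, then
`P = Σ_{z ∈ F} a_z ⟦μ_ε W'(z)⟧` is a finite integral combination of oriented `(k+1)`-faces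
(`F` = the `(k+1)`-faces meeting `spt P`), with the coefficient bound
`|a_z| 𝓗^{k+1}(W'(z) ∩ 𝔹(μ_ε z, ε/4)) ≤ ‖ω_z‖ 𝐌(P)` (`ω_z` the frame covector of the face).
[cite: Federer1969, 4.1.31, 4.2.9] -/
theorem Current.IsRectifiable.exists_eq_sum_faceV {k : ℕ} {P : Current (⊤ : Opens V) (k + 1)}
    (hP : P.IsRectifiable) (b : OrthonormalBasis (Fin n) ℝ V) {ε : ℝ} (hε : 0 < ε)
    (hsupp : P.support ⊆ skeletonV b (k + 1) ε)
    (hbd : ∀ φ : TestForm (⊤ : Opens V) k, tsupport ⇑φ ∩ skeletonV b k ε = ∅ → P.boundary φ = 0) :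
    ∃ (F : Finset (Fin n → ℤ)) (a : (Fin n → ℤ) → ℤ),
      (∀ z ∈ F, faceDim z = k + 1 ∧ (faceV b ε z ∩ P.support).Nonempty) ∧
      P = ∑ z ∈ F, currentOfIntegration (faceV b ε z) (fun _ => a z) (fun _ => faceFrame' b z (k + 1)) ∧
      ∀ z ∈ F, (|(a z : ℝ)|) *
          ((μHE[k + 1] : Measure V) (faceV b ε z ∩ closedBall (faceCenter b ε z) (ε / 4))).toReal ≤
        ‖frameCovector (faceFrame' b z (k + 1))‖ * P.mass.toReal := by
  classical
  have hPm : P.mass ≠ ⊤ := hP.mass_ne_top'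
  set hPr := P.isRepresentable_of_mass_ne_top hPm
  obtain ⟨W, θ, ξ, hd, hPeq, hWK, -, -⟩ := hP.exists_data_subset hP.2 Subset.rfl
  have hWm : MeasurableSet W := hd.1
  -- `‖P‖` does not charge the `k`-skeleton nor the complement of the support
  have hvarW : P.variation = ((μHE[k + 1] : Measure V).restrict W).withDensity fun x => ‖(θ x : ℝ)‖ₑ := by
    conv_lhs => rw [hPeq]
    exact hd.variation_eq
  have hnull_of : ∀ A : Set V, MeasurableSet A → (μHE[k + 1] : Measure V) A = 0 → P.variation A = 0 := by
    intro A hA h0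
    rw [hvarW, withDensity_apply _ hA]
    apply setLIntegral_measure_zero
    rw [Measure.restrict_apply hA]
    exact measure_inter_null_of_null_left W h0
  have hskel : P.variation (skeletonV b k ε) = 0 :=
    hnull_of _ (isClosed_skeletonV b).measurableSet (euclideanHausdorffMeasure_skeletonV_eq_zero b (Nat.lt_succ_self k))
  have hsptc : P.variation (P.supportᶜ) = 0 := by
    have := P.variation_sdiff_support
    rwa [TopologicalSpace.Opens.coe_top, ← Set.compl_eq_univ_sdiff] at this
  -- the faces meeting the support
  have hfin := finite_faces_meeting b hε hP.2.isBounded (ε := ε)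
  set F : Finset (Fin n → ℤ) := hfin.toFinset.filter fun z => faceDim z = k + 1 with hF
  have hFmem : ∀ z, z ∈ F ↔ (faceV b ε z ∩ P.support).Nonempty ∧ faceDim z = k + 1 := fun z => by
    simp [hF, Set.Finite.mem_toFinset]
  -- the union of these faces carries `P`
  have hcover : P.variation (⋃ z ∈ F, faceV b ε z)ᶜ = 0 := by
    refine measure_mono_null (fun x hx => ?_) (measure_union_null hsptc hskel)
    by_cases hxs : x ∈ P.support
    · right
      obtain ⟨z₀, hz₀, hxz₀⟩ := Set.mem_iUnion₂.1 (skeletonV_subset_iUnion_faceV b (k + 1) (hsupp hxs))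
      rcases (Nat.le_succ_iff.1 hz₀) with hle | heq
      · exact skeleton_mono hle (faceV_subset_skeletonV b z₀ hxz₀)
      · exact absurd (Set.mem_iUnion₂.2 ⟨z₀, (hFmem z₀).2 ⟨⟨x, hxz₀, hxs⟩, heq⟩, hxz₀⟩) hx
    · left; exact hxs
  have hPU : P = hPr.restrictSet (⋃ z ∈ F, faceV b ε z) (F.measurableSet_biUnion fun z _ => measurableSet_faceV b z) := by
    conv_lhs => rw [← hPr.restrictSet_univ]
    refine hPr.restrictSet_congr_ae MeasurableSet.univ _ ?_
    refine (ae_eq_univ.2 ?_).symm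
    exact hcover
  -- face by face: `P ⌞ W'(z) = P ⌞ ballV z = a_z ⟦W'(z)⟧`
  have hface : ∀ z ∈ F, ∃ a : ℤ, hPr.restrictSet (faceV b ε z) (measurableSet_faceV b z) =
      currentOfIntegration (faceV b ε z) (fun _ => a) (fun _ => faceFrame' b z (k + 1)) := by
    intro z hz
    obtain ⟨-, hzk⟩ := (hFmem z).1 hz
    have hFB : faceV b ε z ⊆ ballV b ε z := fun x hx => by
      have := (ballV_inter_skeletonV_eq_faceV b (ε := ε) hzk).symm.subset hx; exact this.1
    -- `P ⌞ W'(z) = P ⌞ ballV z`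
    have h1 : hPr.restrictSet (faceV b ε z) (measurableSet_faceV b z) =
        hPr.restrictSet (ballV b ε z) (isOpen_ballV b z).measurableSet := by
      refine hPr.restrictSet_congr_ae _ _ ?_
      refine (ae_eq_set.2 ⟨?_, ?_⟩)
      · rw [Set.sdiff_eq_empty.2 hFB]; exact measure_empty
      · refine measure_mono_null (fun x hx => ?_) hsptc
        intro hxs
        exact hx.2 ((ballV_inter_skeletonV_eq_faceV b (ε := ε) hzk).subset ⟨hx.1, hsupp hxs⟩)
    -- constancy on `ballV z`
    obtain ⟨a, ha⟩ := hP.exists_int_restrictSet_eq_face hPr (faceDirV b z) (faceCenter b ε z)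
      ((finrank_faceDirV b z).trans hzk) (orthonormal_faceFrame b z hzk) (faceFrame_mem b z hzk)
      (isOpen_ballV b z) (by rw [ballV_inter_plane_eq_faceV b hε]; exact (convex_faceV b hε.ne' z).isPreconnected)
      (by rw [ballV_inter_plane_eq_faceV b hε]; exact (euclideanHausdorffMeasure_faceV_lt_top b hε hzk).ne)
      (fun x hx => faceV_subset_plane b z ((ballV_inter_skeletonV_eq_faceV b (ε := ε) hzk).subset ⟨hx.2, hsupp hx.1⟩))
      (fun φ hφ => hbd φ (Set.eq_empty_of_subset_empty fun x hx => by
        have := (ballV_inter_skeletonV_eq_empty b (ε := ε) (show k < faceDim z by omega)).subset ⟨hφ hx.1, hx.2⟩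
        exact this))
    refine ⟨a, ?_⟩
    rw [h1, ha, ballV_inter_plane_eq_faceV b hε, faceFrame'_eq b hzk]
  choose! a ha using hface
  refine ⟨F, a, fun z hz => ⟨((hFmem z).1 hz).2, ((hFmem z).1 hz).1⟩, ?_, fun z hz => ?_⟩
  · rw [hPU, hPr.restrictSet_biUnion_finset F (fun z => faceV b ε z) (fun z => measurableSet_faceV b z)
      fun i _ j _ hij => disjoint_faceV b hij]
    exact Finset.sum_congr rfl fun z hz => ha z hz
  · -- the coefficient bound, by testing against a bump times the frame covector
    obtain ⟨-, hzk⟩ := (hFmem z).1 hz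
    set e := faceFrame' b z (k + 1) with he_def
    have he : Orthonormal ℝ e := by rw [he_def, faceFrame'_eq b hzk]; exact orthonormal_faceFrame b z hzk
    set c := faceCenter b ε z
    set χ : ContDiffBump c := ⟨ε / 4, ε / 2, by positivity, by linarith⟩
    set χT : 𝓓((⊤ : Opens V), ℝ) := ⟨χ, χ.contDiff, χ.hasCompactSupport, by simp⟩
    set φ : TestForm (⊤ : Opens V) (k + 1) := smulCovectorCLM (frameCovector e) χT with hφ
    have hφx : ∀ x, φ x = χ x • frameCovector e := fun x => rfl
    have hφb : ∀ x, ‖φ x‖ ≤ ‖frameCovector e‖ := fun x => by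
      rw [hφx, norm_smul, Real.norm_eq_abs, abs_of_nonneg (χ.nonneg' x)]
      exact mul_le_of_le_one_left (norm_nonneg _) χ.le_one
    -- the value of `P ⌞ W'(z)` on `φ`
    have hfinμ : (μHE[k + 1] : Measure V) (faceV b ε z) < ⊤ := euclideanHausdorffMeasure_faceV_lt_top b hε hzk
    haveI : IsFiniteMeasure ((μHE[k + 1] : Measure V).restrict (faceV b ε z)) :=
      ⟨by rw [Measure.restrict_apply_univ]; exact hfinμ⟩
    have hloc : LocallyIntegrableOn (fun _ : V => ((a z : ℤ) : ℝ) • frameVector e) ((⊤ : Opens V) : Set V)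
        ((μHE[k + 1] : Measure V).restrict (faceV b ε z)) :=
      (integrable_const _).locallyIntegrable.locallyIntegrableOn _
    have hval : hPr.restrictSet (faceV b ε z) (measurableSet_faceV b z) φ =
        (a z : ℝ) * ∫ x in faceV b ε z, χ x ∂(μHE[k + 1] : Measure V) := by
      rw [ha z hz, currentOfIntegration_apply hloc, ← integral_const_mul]
      refine setIntegral_congr_fun (measurableSet_faceV b z) fun x _ => ?_
      rw [hφx, ContinuousAlternatingMap.smul_apply, frameCovector_self he, smul_eq_mul, mul_one]
    -- lower bound of the integral of the bump over the face
    have hlow : ((μHE[k + 1] : Measure V) (faceV b ε z ∩ closedBall c (ε / 4))).toReal ≤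
        ∫ x in faceV b ε z, χ x ∂(μHE[k + 1] : Measure V) := by
      have hint : IntegrableOn (fun x => χ x) (faceV b ε z) (μHE[k + 1] : Measure V) :=
        (integrable_const (1 : ℝ)).mono' χ.continuous.aestronglyMeasurable
          (Eventually.of_forall fun x => by rw [Real.norm_eq_abs, abs_of_nonneg (χ.nonneg' x)]; exact χ.le_one)
      calc ((μHE[k + 1] : Measure V) (faceV b ε z ∩ closedBall c (ε / 4))).toReal
          = ∫ _ in faceV b ε z ∩ closedBall c (ε / 4), (1 : ℝ) ∂(μHE[k + 1] : Measure V) := by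
            rw [setIntegral_const, smul_eq_mul, mul_one, Measure.real]
        _ = ∫ x in faceV b ε z ∩ closedBall c (ε / 4), χ x ∂(μHE[k + 1] : Measure V) := by
            refine setIntegral_congr_fun ((measurableSet_faceV b z).inter measurableSet_closedBall) fun x hx => ?_
            exact (χ.one_of_mem_closedBall hx.2).symm
        _ ≤ ∫ x in faceV b ε z, χ x ∂(μHE[k + 1] : Measure V) :=
            setIntegral_mono_set hint (Eventually.of_forall fun x => χ.nonneg' x)
              (Eventually.of_forall Set.inter_subset_left)
    -- upper bound by the mass
    have hup : |hPr.restrictSet (faceV b ε z) (measurableSet_faceV b z) φ| ≤ ‖frameCovector e‖ * P.mass.toReal := by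
      have hm : (hPr.restrictSet (faceV b ε z) (measurableSet_faceV b z)).mass ≠ ⊤ :=
        ne_top_of_le_ne_top hPm ((hPr.mass_restrictSet_le _).trans (P.variation_le_mass _))
      refine ((hPr.restrictSet (faceV b ε z) (measurableSet_faceV b z)).abs_apply_le_mul_toReal_mass' hm
        (norm_nonneg _) hφb).trans ?_
      refine mul_le_mul_of_nonneg_left (ENNReal.toReal_mono hPm ?_) (norm_nonneg _)
      exact (hPr.mass_restrictSet_le _).trans (P.variation_le_mass _)
    calc |(a z : ℝ)| * ((μHE[k + 1] : Measure V) (faceV b ε z ∩ closedBall c (ε / 4))).toReal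
        ≤ |(a z : ℝ)| * ∫ x in faceV b ε z, χ x ∂(μHE[k + 1] : Measure V) :=
          mul_le_mul_of_nonneg_left hlow (abs_nonneg _)
      _ = |hPr.restrictSet (faceV b ε z) (measurableSet_faceV b z) φ| := by
          rw [hval, abs_mul, abs_of_nonneg (setIntegral_nonneg (measurableSet_faceV b z) fun x _ => χ.nonneg' x)]
      _ ≤ ‖frameCovector e‖ * P.mass.toReal := hup

/-- **Finiteness of the polyhedral approximations** [Federer1969, 4.2.17, proof: "Φ₂ and Ψ₂ are
finite"]: for a bounded `K` and a mass bound `M < ∞`, only finitely many rectifiable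
`(k+1)`-currents carried by `μ_ε W'_{k+1} ∩ K` with boundary off `μ_ε W'_k` have mass `≤ M` — each is
`Σ_{z ∈ F} a_z ⟦W'(z)⟧` over the finitely many faces meeting `K`, with bounded integer coefficients.
[cite: Federer1969, 4.2.9, 4.2.17] -/
theorem Cubical.finite_setOf_polyhedral (b : OrthonormalBasis (Fin n) ℝ V) {ε : ℝ} (hε : 0 < ε) (k : ℕ)
    {K : Set V} (hK : Bornology.IsBounded K) {M : ℝ≥0∞} (hM : M ≠ ⊤) :
    {P : Current (⊤ : Opens V) (k + 1) | P.IsRectifiable ∧ P.support ⊆ K ∧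
      P.support ⊆ skeletonV b (k + 1) ε ∧
      (∀ φ : TestForm (⊤ : Opens V) k, tsupport ⇑φ ∩ skeletonV b k ε = ∅ → P.boundary φ = 0) ∧
      P.mass ≤ M}.Finite := by
  classical
  -- the finitely many `(k+1)`-faces meeting `K`, and the coefficient boxes
  have hfin := finite_faces_meeting b hε hK (ε := ε)
  set F₀ : Finset (Fin n → ℤ) := hfin.toFinset.filter fun z => faceDim z = k + 1 with hF₀
  set μz : (Fin n → ℤ) → ℝ := fun z =>
    ((μHE[k + 1] : Measure V) (faceV b ε z ∩ closedBall (faceCenter b ε z) (ε / 4))).toReal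
  set B : (Fin n → ℤ) → ℤ := fun z => ⌈‖frameCovector (faceFrame' b z (k + 1))‖ * M.toReal / μz z⌉
  have hμz : ∀ z ∈ F₀, 0 < μz z := by
    intro z hz
    have hzk : faceDim z = k + 1 := (Finset.mem_filter.1 hz).2
    refine ENNReal.toReal_pos (euclideanHausdorffMeasure_faceV_inter_closedBall_pos b hε hzk (by positivity)
      (by linarith)).ne' ?_
    exact (lt_of_le_of_lt (measure_mono Set.inter_subset_left) (euclideanHausdorffMeasure_faceV_lt_top b hε hzk)).ne
  -- parameter set and map
  set Par : Set (Finset (Fin n → ℤ) × (↥F₀ → ℤ)) :=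
    (↑F₀.powerset : Set (Finset (Fin n → ℤ))) ×ˢ Set.pi Set.univ fun z => Set.Icc (-B z.1) (B z.1)
  have hPar : Par.Finite := (F₀.powerset.finite_toSet).prod (Set.Finite.pi fun z => Set.finite_Icc _ _)
  set f : Finset (Fin n → ℤ) × (↥F₀ → ℤ) → Current (⊤ : Opens V) (k + 1) := fun q =>
    ∑ z ∈ q.1, currentOfIntegration (faceV b ε z)
      (fun _ => if h : z ∈ F₀ then q.2 ⟨z, h⟩ else 0) (fun _ => faceFrame' b z (k + 1))
  refine (hPar.image f).subset ?_
  rintro P ⟨hPr, hPK, hPs, hbd, hPM⟩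
  obtain ⟨F, a, hF, hPeq, hcoef⟩ := hPr.exists_eq_sum_faceV b hε hPs hbd
  have hFF₀ : F ⊆ F₀ := fun z hz => by
    obtain ⟨hzk, x, hxF, hxP⟩ := hF z hz
    exact Finset.mem_filter.2 ⟨hfin.mem_toFinset.2 ⟨x, hxF, hPK hxP⟩, hzk⟩
  set a₀ : ↥F₀ → ℤ := fun z => if z.1 ∈ F then a z.1 else 0
  refine ⟨(F, a₀), ⟨Finset.mem_powerset.2 hFF₀ |> fun h => by exact_mod_cast h, fun z _ => ?_⟩, ?_⟩
  · -- coefficients in the box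
    show a₀ z ∈ Set.Icc (-B z.1) (B z.1)
    by_cases hzF : z.1 ∈ F
    · have hb : |(a z.1 : ℝ)| ≤ ‖frameCovector (faceFrame' b z.1 (k + 1))‖ * M.toReal / μz z.1 := by
        rw [le_div_iff₀ (hμz z.1 z.2)]
        refine (hcoef z.1 hzF).trans (mul_le_mul_of_nonneg_left (ENNReal.toReal_mono hM hPM) (norm_nonneg _))
      have hb' : |(a z.1 : ℝ)| ≤ B z.1 := hb.trans (Int.le_ceil _)
      simp only [a₀, hzF, if_true, Set.mem_Icc]
      have h1 := (abs_le.1 hb').1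
      have h2 := (abs_le.1 hb').2
      constructor
      · exact_mod_cast h1
      · exact_mod_cast h2
    · simp only [a₀, hzF, if_false, Set.mem_Icc, Left.neg_nonpos_iff]
      have : (0 : ℤ) ≤ B z.1 := by
        have : (0 : ℝ) ≤ B z.1 := le_trans (by positivity) (Int.le_ceil (‖frameCovector (faceFrame' b z.1 (k + 1))‖ * M.toReal / μz z.1))
        exact_mod_cast this
      exact ⟨this, this⟩
  · -- `f (F, a₀) = P`
    rw [hPeq]
    refine Finset.sum_congr rfl fun z hz => ?_
    have h1 : (if h : z ∈ F₀ then a₀ ⟨z, h⟩ else 0) = a z := by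
      rw [dif_pos (hFF₀ hz)]
      simp [a₀, hz]
    simp_rw [h1]

end Polyhedral

end Literature.Geometry.GeometricMeasureTheory
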